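import Mathlib

/-!
# Crux `WordLengthQP` (stmt-ValiantsHypothesis-6623), line `Sketch` (eps-order-ladder) —
rung `q = 1`: the calculus of the one-walk quadratic forms (merging and absorption)

By `rungOne_oneWalk_normal_form` (p121679) an order-one border width-2 S-affine program with
invertible skeleton computes `f = Σ_t κ_t · Q(N_t)(r_t)` where
`Q(N)(p, q) := p² N₀₁ − q² N₁₀ + p q (N₁₁ − N₀₀)` and `r_t = e₀ᵀ A₁ ⋯ A_{t-1}` is the prefix
row-walk of ONE word.  The two rewriting rules of this representation, for the planners' degree
bookkeeping (line card `Lines/Sketch.md` v5):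

* `oneWalk_Q_add`, `oneWalk_Q_smul` — VERTEX MERGING: `Q` is linear in the insertion `N`, so all
  positions with the same prefix merge into one quadratic form;
* `oneWalk_Q_absorb` — NEIGHBOUR ABSORPTION: moving an insertion across a letter conjugates it,
  `Q(N)(r · A) = Q(A · N · adj A)(r)` for every `2 × 2` matrix `A` (entries of the insertion gain
  degree `≤ 2 · deg A`).  Pushing every insertion to the start recovers the conjugation-sum form
  `f = (Σ_t κ_t U_t N_t adj U_t)₀₁`; pushing them outward is how far excursions of the walk are
  charged with high-degree tops.
-/

-- `Summit.ValiantsHypothesis.ValiantsHypothesis.…` is the tree's mandated single-conjunct layout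
-- (Sub = Summit), so the duplicated namespace component is intended.
set_option linter.dupNamespace false

namespace Summit.ValiantsHypothesis.ValiantsHypothesis.Cruxes.WordLengthQP.EpsOrderLadder

/-- Vertex merging, additivity: `Q(N + N') = Q(N) + Q(N')`. [folklore] -/
theorem oneWalk_Q_add {R : Type} [CommRing R] (N N' : Matrix (Fin 2) (Fin 2) R) (p q : R) :
    p ^ 2 * (N + N') 0 1 - q ^ 2 * (N + N') 1 0 + p * q * ((N + N') 1 1 - (N + N') 0 0) =
      (p ^ 2 * N 0 1 - q ^ 2 * N 1 0 + p * q * (N 1 1 - N 0 0)) +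
        (p ^ 2 * N' 0 1 - q ^ 2 * N' 1 0 + p * q * (N' 1 1 - N' 0 0)) := by
  simp only [Matrix.add_apply]
  ring

/-- Vertex merging, homogeneity: `Q(c • N) = c · Q(N)`. [folklore] -/
theorem oneWalk_Q_smul {R : Type} [CommRing R] (c : R) (N : Matrix (Fin 2) (Fin 2) R) (p q : R) :
    p ^ 2 * (c • N) 0 1 - q ^ 2 * (c • N) 1 0 + p * q * ((c • N) 1 1 - (c • N) 0 0) =
      c * (p ^ 2 * N 0 1 - q ^ 2 * N 1 0 + p * q * (N 1 1 - N 0 0)) := by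
  simp only [Matrix.smul_apply, smul_eq_mul]
  ring

/-- **Neighbour absorption.**  Moving an insertion across a letter conjugates it: for every
`2 × 2` matrix `A` and row `r = (p, q)`, with `r · A = (p A₀₀ + q A₁₀, p A₀₁ + q A₁₁)`,
`Q(N)(r · A) = Q(A · N · adj A)(r)`. [folklore] -/
theorem oneWalk_Q_absorb {R : Type} [CommRing R] (A N : Matrix (Fin 2) (Fin 2) R) (p q : R) :
    (p * A 0 0 + q * A 1 0) ^ 2 * N 0 1 - (p * A 0 1 + q * A 1 1) ^ 2 * N 1 0 +
        (p * A 0 0 + q * A 1 0) * (p * A 0 1 + q * A 1 1) * (N 1 1 - N 0 0) =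
      p ^ 2 * (A * N * A.adjugate) 0 1 - q ^ 2 * (A * N * A.adjugate) 1 0 +
        p * q * ((A * N * A.adjugate) 1 1 - (A * N * A.adjugate) 0 0) := by
  rw [Matrix.adjugate_fin_two]
  simp only [Matrix.mul_apply, Fin.sum_univ_two, Matrix.of_apply, Matrix.cons_val',
    Matrix.cons_val_zero, Matrix.cons_val_one, Matrix.cons_val_fin_one]
  ring

/-- The quadratic form at the start of the walk reads off the `(0,1)` entry:
`Q(N)(e₀) = N₀₁`. [folklore] -/
theorem oneWalk_Q_start {R : Type} [CommRing R] (N : Matrix (Fin 2) (Fin 2) R) :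
    (1 : R) ^ 2 * N 0 1 - (0 : R) ^ 2 * N 1 0 + 1 * 0 * (N 1 1 - N 0 0) = N 0 1 := by
  ring

end Summit.ValiantsHypothesis.ValiantsHypothesis.Cruxes.WordLengthQP.EpsOrderLadder
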